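import Summits.MatrixMultiplication.OmegaCensus.STPPVosperSlackOneCoverLawA2E
import Summits.MatrixMultiplication.OmegaCensus.STPPVosperTilingWordsPruned
import Summits.MatrixMultiplication.OmegaCensus.STPPVosperCoverEK1GAsm
import Summits.MatrixMultiplication.OmegaCensus.STPPVosperCoverEK1AAsm
import Summits.MatrixMultiplication.OmegaCensus.STPPVosperCoverEK1B
import Summits.MatrixMultiplication.OmegaCensus.STPPVosperCoverEK1Tables
import Summits.MatrixMultiplication.OmegaCensus.STPPHamidouneRodsethInverseTheorem
import Summits.MatrixMultiplication.OmegaCensus.STPPVosperClash61Tools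

/-!
# ω-census (abelian STPP census): an UNCONDITIONAL kill at `ℤ₆₁` by the slack-1 cover+words law — K1 `{(1,1,2),(2,2,3),(3,4,2),(3,4,2)}` (kernel)

HONEST FRAMING (pub-omega census; verbatim): lottery ticket; floor = certified bounds/negative ranges.
Census STRUCTURE (seat pub-omega-stpp-1 gen 32, 2026-08-28), family (b2).  The pattern K1 `{(1,1,2),(2,2,3),(3,4,2)²}` is a leaf of the `ℤ₆₁` residual
front of record that the window-table laws leave open (β₂ survivors `±3⁻¹ = 20, 41` in the reading `(3,2,4)`; HOME `pub-omega-stpp-1-g32/scan/KERNEL-HR-KILLS-Z61.json`).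
Here it is excluded in the reading `(a,b,c) = (2,3,4)` — the STPP family `(C, A, B)`, block `3` of sizes `(2,3,4)`, `(z, b, vol, a, L) = (16, 3, 24, 2, 17)`,
slack one (`16 + 3 + 24 + 2 + 17 = 62`), `(m, n) = (18, 42)` — by `no_isSTPP_of_slack_one_coverE_prime_a2` (`STPPVosperSlackOneCoverLawA2E.lean`: stpp-2's
`a = 2` cover+words law with the escapes decided by `existsCoverW` over the pruned enumerator `blockDiffsWP`): the three window tables leave the ratios `30, 31 = ±2⁻¹`
(`STPPVosperCoverEK1Tables.lean`, `admbulkK1`), and for these every configuration of every case dies at the cover+words stage — γ: `2 × 17` missing indices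
(`STPPVosperCoverEK1G1–5.lean`, `…GAsm`); α₂: `2 × 8 × 4` admissible offsets (`…EK1A1–8.lean`, `…AAsm`); β: `2 × 3` shapes (`…EK1B.lean`) — 104 kernel searches of
≈ 20 s.  UNCONDITIONAL: `hamidouneRodsethInverseTheorem_holds`.  Python ×2 code-disjoint: HOME `pub-omega-stpp-1-g32/code/k1_gen.py` (exact mirror of `blockDiffsWP` /
`existsCoverW`) and stpp-2 g25 `cover3.py` (words kill every tested shape).  Nothing here is progress on `ω`.

References: A. G. Vosper, J. London Math. Soc. 31 (1956); Y. O. Hamidoune, Ø. J. Rødseth, Acta Arith. 92 (2000); H. Cohn, R. Kleinberg, B. Szegedy, C. Umans,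
FOCS 2005 (arXiv:math/0511460), Def. 5.1.
-/

open Finset
open scoped Pointwise

namespace Summit.MatrixMultiplication.OmegaCensus.CubeNB

open Literature.Computability.AlgebraicComplexity
open Literature.Combinatorics.Additive
open Summit.MatrixMultiplication.OmegaCensus.STPPKneser

/-! ## Splits -/

section Splits

/-- Split of the γ target: words, or (`j = 30, 31`) a failed cover+words search for every missing index. [folklore] -/
theorem splitEK1_gamma : ∀ jv ∈ ({0, 1, 60, 2, 59, 30, 31} : Finset ℕ),
    (jv = 0 ∨ (∃ k ∈ range 3, 1 ≤ k ∧ (jv = k ∨ jv + k = 61)) ∨ (∃ k ∈ range 2, 1 ≤ k ∧ (jv * k % 61 = 1 ∨ jv * k % 61 = 61 - 1))) ∨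
      ∀ ν < 16 + 1, existsCoverW 61 ((List.range 17).map fun t => (jv * t) % 61) ((List.range (16 + 1)).filter fun t => decide (t ≠ ν))
          ([((2 : ℕ), (3 : ℕ), (4 : ℕ)), (3, 2, 2), (2, 1, 1)].map fun s =>
            blockDiffsWP 61 ((List.range 17).map fun t => (jv * t) % 61) ((List.range (16 + 1)).filter fun t => decide (t ≠ ν)) s.1 s.2.1 s.2.2) [] [] [] = false ∨
        existsCoverW 61 ((List.range (16 + 1)).filter fun t => decide (t ≠ ν)) ((List.range 17).map fun t => (jv * t) % 61)
          ([((3 : ℕ), (2 : ℕ), (4 : ℕ)), (2, 3, 2), (1, 2, 1)].map fun s =>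
            blockDiffsWP 61 ((List.range (16 + 1)).filter fun t => decide (t ≠ ν)) ((List.range 17).map fun t => (jv * t) % 61) s.1 s.2.1 s.2.2) [] [] [] = false := by
  intro jv hjv
  have hcases : jv ∈ ({0, 1, 60, 2, 59} : Finset ℕ) ∨ jv = 30 ∨ jv = 31 := by
    revert hjv; revert jv; decide
  rcases hcases with h | rfl | rfl
  · exact Or.inl (target_61_a2_b3 jv h)
  · exact Or.inr fun ν hν => Or.inl (ceK1_g_j30 ν hν)
  · exact Or.inr fun ν hν => Or.inl (ceK1_g_j31 ν hν)

/-- Split of the β target: words, or (`j = 30, 31`) the failed cover+words searches for the three `Z°`-shapes. [folklore] -/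
theorem splitEK1_beta : ∀ jv ∈ ({0, 1, 60, 2, 59, 30, 31} : Finset ℕ),
    (jv = 0 ∨ (∃ k ∈ range 3, 1 ≤ k ∧ (jv = k ∨ jv + k = 61)) ∨ (∃ k ∈ range 2, 1 ≤ k ∧ (jv * k % 61 = 1 ∨ jv * k % 61 = 61 - 1))) ∨
      ((∀ k < 3 + 42 + 1, (2 ≤ k ∧ k + 2 ≤ 3 + 42) ∨ k = 0 ∨ k = 3 + 42 ∨
          (existsCoverW 61 ((List.range 17).map fun t => (jv * t) % 61) (List.range (16 - 1) ++ [k + 16 - 1])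
              ([((2 : ℕ), (3 : ℕ), (4 : ℕ)), (3, 2, 2), (2, 1, 1)].map fun s =>
                blockDiffsWP 61 ((List.range 17).map fun t => (jv * t) % 61) (List.range (16 - 1) ++ [k + 16 - 1]) s.1 s.2.1 s.2.2) [] [] [] = false ∨
            existsCoverW 61 (List.range (16 - 1) ++ [k + 16 - 1]) ((List.range 17).map fun t => (jv * t) % 61)
              ([((3 : ℕ), (2 : ℕ), (4 : ℕ)), (2, 3, 2), (1, 2, 1)].map fun s =>
                blockDiffsWP 61 (List.range (16 - 1) ++ [k + 16 - 1]) ((List.range 17).map fun t => (jv * t) % 61) s.1 s.2.1 s.2.2) [] [] [] = false)) ∧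
        (existsCoverW 61 ((List.range 17).map fun t => (jv * t) % 61) (List.range 16)
            ([((2 : ℕ), (3 : ℕ), (4 : ℕ)), (3, 2, 2), (2, 1, 1)].map fun s =>
              blockDiffsWP 61 ((List.range 17).map fun t => (jv * t) % 61) (List.range 16) s.1 s.2.1 s.2.2) [] [] [] = false ∨
          existsCoverW 61 (List.range 16) ((List.range 17).map fun t => (jv * t) % 61)
            ([((3 : ℕ), (2 : ℕ), (4 : ℕ)), (2, 3, 2), (1, 2, 1)].map fun s =>
              blockDiffsWP 61 (List.range 16) ((List.range 17).map fun t => (jv * t) % 61) s.1 s.2.1 s.2.2) [] [] [] = false)) := by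
  intro jv hjv
  have hcases : jv ∈ ({0, 1, 60, 2, 59} : Finset ℕ) ∨ jv = 30 ∨ jv = 31 := by
    revert hjv; revert jv; decide
  rcases hcases with h | rfl | rfl
  · exact Or.inl (target_61_a2_b3 jv h)
  · refine Or.inr ⟨fun k hk => ?_, Or.inl ceK1_b_j30_run⟩
    rcases (show (2 ≤ k ∧ k + 2 ≤ 3 + 42) ∨ k = 0 ∨ k = 3 + 42 ∨ k = 1 ∨ k = 44 by omega) with h | h | h | rfl | rfl
    · exact Or.inl h
    · exact Or.inr (Or.inl h)
    · exact Or.inr (Or.inr (Or.inl h))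
    · exact Or.inr (Or.inr (Or.inr (Or.inl ceK1_b_j30_k1)))
    · exact Or.inr (Or.inr (Or.inr (Or.inl ceK1_b_j30_k44)))
  · refine Or.inr ⟨fun k hk => ?_, Or.inl ceK1_b_j31_run⟩
    rcases (show (2 ≤ k ∧ k + 2 ≤ 3 + 42) ∨ k = 0 ∨ k = 3 + 42 ∨ k = 1 ∨ k = 44 by omega) with h | h | h | rfl | rfl
    · exact Or.inl h
    · exact Or.inr (Or.inl h)
    · exact Or.inr (Or.inr (Or.inl h))
    · exact Or.inr (Or.inr (Or.inr (Or.inl ceK1_b_j31_k1)))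
    · exact Or.inr (Or.inr (Or.inr (Or.inl ceK1_b_j31_k44)))

end Splits

/-! ## The kill -/

section Kill

/-- **K1 `{(1,1,2),(2,2,3),(3,4,2),(3,4,2)}` has no STPP family in `ℤ/61ℤ`** — UNCONDITIONAL (slack-1 law for `a = 2` with cover+words escapes over the pruned
enumerator, family `(C, A, B)`, block `3`; see the module docstring). [cite: CohnKleinbergSzegedyUmans2005, Def. 5.1]
[cite: Vosper1956, main theorem; Nathanson1996, Thm 2.7] [cite: HamidouneRodseth2000, main theorem (§1, p. 252)] -/
theorem no_isSTPP_zmod61_112_223_342_342 (A B C : Fin 4 → Finset (ZMod 61)) (hS : IsSTPP A B C)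
    (hA : ∀ i, #(A i) = ![1, 2, 3, 3] i) (hB : ∀ i, #(B i) = ![1, 2, 4, 4] i) (hC : ∀ i, #(C i) = ![2, 3, 2, 2] i) : False := by
  haveI : Fact (Nat.Prime 61) := ⟨prime_61⟩
  have hS' : IsSTPP C A B := stpp_rotate (stpp_rotate hS)
  have hAne : ∀ i, (A i).Nonempty := fun i => card_pos.1 (by rw [hA]; fin_cases i <;> simp)
  have hBne : ∀ i, (B i).Nonempty := fun i => card_pos.1 (by rw [hB]; fin_cases i <;> simp)
  have hCne : ∀ i, (C i).Nonempty := fun i => card_pos.1 (by rw [hC]; fin_cases i <;> simp)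
  have e3 : (univ : Finset (Fin 4)).erase 3 = {0, 1, 2} := by decide
  have hz : ∑ k ∈ (univ : Finset (Fin 4)).erase 3, #(C k) * #(B k) = 16 := by
    rw [e3, Finset.sum_insert (by decide), Finset.sum_pair (by decide)]; simp [hB, hC]
  have hL : ∑ k ∈ (univ : Finset (Fin 4)).erase 3, #(A k) * #(B k) = 17 := by
    rw [e3, Finset.sum_insert (by decide), Finset.sum_pair (by decide)]; simp [hA, hB]
  have ha : #(C 3) = 2 := by rw [hC]; simp
  have hb : #(A 3) = 3 := by rw [hA]; simp
  have hvol : #(C 3) * #(A 3) * #(B 3) = 24 := by rw [hA, hB, hC]; simp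
  have hsAB : [((2 : ℕ), (3 : ℕ), (4 : ℕ)), (3, 2, 2), (2, 1, 1)] = ([2, 1, 0] : List (Fin 4)).map (fun k => (#(C k), #(A k), #(B k))) := by
    simp [hA, hB, hC]
  have hsBA : [((3 : ℕ), (2 : ℕ), (4 : ℕ)), (2, 3, 2), (1, 2, 1)] = ([2, 1, 0] : List (Fin 4)).map (fun k => (#(A k), #(C k), #(B k))) := by
    simp [hA, hB, hC]
  exact no_isSTPP_of_slack_one_coverE_prime_a2 (blockEnumSound_blockDiffsWP 61) hamidouneRodsethInverseTheorem_holds C A B hS' hCne hAne hBne 3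
    ⟨0, by decide⟩ ha hb hvol hz hL rfl (by norm_num) (by norm_num) (by norm_num) (by norm_num) (m := 18) (n := 42) rfl rfl
    [2, 1, 0] (by decide) (fun k => by fin_cases k <;> decide) _ hsAB _ hsBA false
    (Jγ := {0, 1, 60, 2, 59, 30, 31}) (Jα := {0, 1, 60, 2, 59}) (Jβ := {0, 1, 60, 2, 59, 30, 31})
    table61_42_18_3_K1 splitEK1_gamma specEK1 target_61_a2_b3 tableB61_43_18_3 splitEK1_beta

end Kill

end Summit.MatrixMultiplication.OmegaCensus.CubeNB
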